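import Mathlib
import Summits.MatrixMultiplication.Statement
import Summits.MatrixMultiplication.MatrixMultiplication.Theorems.GraphEquationsSystems
import Summits.MatrixMultiplication.MatrixMultiplication.Theorems.GraphEquationsKernel
import Summits.MatrixMultiplication.MatrixMultiplication.Theorems.GraphEquationsInitialForms

/-!
# Pure isolated initial forms: the line «initial-form rank» beneath `H_mult` (`GraphEquations`, kernel M9a)

Decomp-mm node «GraphEquations» (lens 5); attacked leaf `MultiplicityReduction` (`H_mult`).
Target of the node, VERBATIM: `_root_.MatrixMultiplication`.

`GraphEquationsInitialForms` proved: a cheap system whose bounded-order weighted initial forms at a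
point are PURE (polynomials `P_o(f)` in the generators `f_q = c_q − Σ_k a_{q₁k} b_{kq₂}`) with a
full-rank GRADIENT MATRIX forces `ω ≤ β` (`omega_le_of_eqAdmissibleInit`), and
`H_init → H_mult`.  This module splits the rank hypothesis into its two natural halves and names
them, so that the crux line «initial-form rank» is stated over tree declarations:

* `EqSystem.PureIsolatedAt K x` — the initial forms of orders `≤ K` of the shifted tests are pure,
  `= P_o(f)`, and the fibre of `P = (P_o)_o` through the origin of `F`-space is the origin alone
  (`{F | ∀ o, P_o(F) = P_o(0)} = {0}`: SET-THEORETIC nondegeneracy — what correctness gives for the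
  full initial ideal of the tests at a generic point of `W_n`, the normal cone of the test scheme
  along `W_n` being generically the zero section);
* `IsolatedForcesRank` — commutative algebra in characteristic `0`: an isolated fibre of a
  polynomial map `P : ℂ^{n²} → ℂ^T` forces generic Jacobian rank `n²` (fibre dimension +
  Jacobian criterion for algebraic independence); a THEOREM-CANDIDATE, stated as a named `Prop`;
* `Purification` — the open core re-typed: cheap correct systems can be made cheap, correct, with
  pure isolated initial forms of bounded order at some point of the graph;
* glue: `initNondegAt_of_pureIsolatedAt`, `eqAdmissibleInit_of_pure`,
  `initialFormReduction_of_purification : IsolatedForcesRank → Purification → H_init`,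
  `multiplicityReduction_of_purification : … → H_mult`,
  `matrixMultiplication_of_quadratic_of_purification : V → … → S`.

No `sorry`; the two named statements enter as hypotheses only.

Sources: [BurgisserClausenShokrollahi1997, Problem 16.3, Prop. (14.1)]; [Strassen1973];
Mora's tangent-cone algorithm / standard bases for the purification step (T. Mora, *An algorithm
to compute the equations of tangent cones*, EUROCAM 1982) — cited as the classical tool, not used.
-/

set_option linter.dupNamespace false

noncomputable section

open scoped BigOperators

namespace Summit.MatrixMultiplication.MatrixMultiplication.Theorems.GraphEquations

open MvPolynomial
open Literature.Computability.AlgebraicComplexity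

variable {n : ℕ}

namespace EqSystem

/-- **PURE ISOLATED initial forms to order `K` at `x`.**  For each test there is an order
`m_o ≤ K` at which the weighted component of the shifted test is a polynomial `P_o(f)` in the
generators (PURE), and the fibre of `P` through `0` is `{0}` (ISOLATED). -/
def PureIsolatedAt (E : EqSystem n) (K : ℕ) (x : GraphVars n → ℂ) : Prop :=
  ∃ (m : Fin E.tests.length → ℕ) (P : Fin E.tests.length → MvPolynomial (Fin n × Fin n) ℂ),
    (∀ o, m o ≤ K) ∧
    (∀ o, weightedHomogeneousComponent (gw n) (m o)
        (bind₁ (shift x) (E.testPoly (E.tests.get o))) = aeval (generator n) (P o)) ∧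
    (∀ F₀ : Fin n × Fin n → ℂ, (∀ o, eval F₀ (P o) = eval 0 (P o)) → F₀ = 0)

/-- Pure isolated initial forms to order `K` at SOME point of the graph. -/
def PureIsolated (E : EqSystem n) (K : ℕ) : Prop := ∃ x ∈ mmGraph n, E.PureIsolatedAt K x

end EqSystem

/-- `EqAdmissiblePure β`: correct systems of cost `O(n^β)` with pure isolated initial forms of a
bounded order at some point of the graph exist for all `n ≥ 1`. -/
def EqAdmissiblePure (β : ℝ) : Prop :=
  ∃ (K : ℕ) (c : ℝ), ∀ n : ℕ, 1 ≤ n → ∃ E : EqSystem n, E.Correct ∧ E.PureIsolated K ∧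
    (E.cost : ℝ) ≤ c * (n : ℝ) ^ β

/-- **`IsolatedForcesRank` (named statement; commutative algebra, characteristic `0`;
theorem-candidate).**  If the fibre through `0` of a polynomial map `P = (P_o)_{o<T} : ℂ^{n×n} → ℂ^T`
is `{0}`, then the gradient matrix `(∂P_o/∂F_q)(γ)` has rank `n²` at some `γ`.  (Fibre dimension:
`dim im P = n²`, so `P` contains `n²` algebraically independent coordinates; Jacobian criterion.) -/
def IsolatedForcesRank : Prop :=
  ∀ (n T : ℕ) (P : Fin T → MvPolynomial (Fin n × Fin n) ℂ),
    (∀ F₀ : Fin n × Fin n → ℂ, (∀ o, eval F₀ (P o) = eval 0 (P o)) → F₀ = 0) →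
    ∃ γ : Fin n × Fin n → ℂ, (gradMatrix γ P).rank = n * n

/-- **`Purification` (the open core of `H_mult`, re-typed by higher-order truncation).**  A correct
system of cost `O(n^β)` can be replaced, for every `β' > β`, by a correct system of cost
`O(n^{β'})` with pure isolated initial forms of bounded order at some point of the graph. -/
def Purification : Prop :=
  ∀ β : ℝ, 2 ≤ β → EqAdmissible β → ∀ β' : ℝ, β < β' → EqAdmissiblePure β'

/-- Pure isolated ⇒ initial-form nondegenerate (given `IsolatedForcesRank`). -/
theorem initNondegAt_of_pureIsolatedAt (hJ : IsolatedForcesRank) {E : EqSystem n} {K : ℕ}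
    {x : GraphVars n → ℂ} (h : E.PureIsolatedAt K x) : E.InitNondegAt K x := by
  obtain ⟨m, P, hm, hinit, hiso⟩ := h
  obtain ⟨γ, hγ⟩ := hJ n E.tests.length P hiso
  exact ⟨m, P, γ, hm, hinit, hγ⟩

/-- `EqAdmissiblePure β → EqAdmissibleInit β` (given `IsolatedForcesRank`). -/
theorem eqAdmissibleInit_of_pure (hJ : IsolatedForcesRank) {β : ℝ} (h : EqAdmissiblePure β) :
    EqAdmissibleInit β := by
  obtain ⟨K, c, hc⟩ := h
  refine ⟨K, c, fun n hn => ?_⟩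
  obtain ⟨E, hE, ⟨x, hx, hP⟩, hcost⟩ := hc n hn
  exact ⟨E, hE, ⟨x, hx, initNondegAt_of_pureIsolatedAt hJ hP⟩, hcost⟩

/-- `EqAdmissiblePure β → ω ≤ β` (given `IsolatedForcesRank`). -/
theorem omega_le_of_eqAdmissiblePure (hJ : IsolatedForcesRank) {β : ℝ} (h : EqAdmissiblePure β) :
    omega ℂ ≤ β :=
  omega_le_of_eqAdmissibleInit (eqAdmissibleInit_of_pure hJ h)

/-- **`IsolatedForcesRank → Purification → H_init`.** -/
theorem initialFormReduction_of_purification (hJ : IsolatedForcesRank) (hP : Purification) :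
    InitialFormReduction :=
  fun β hβ hE β' hβ' => eqAdmissibleInit_of_pure hJ (hP β hβ hE β' hβ')

/-- **`IsolatedForcesRank → Purification → H_mult`.** -/
theorem multiplicityReduction_of_purification (hJ : IsolatedForcesRank) (hP : Purification) :
    MultiplicityReduction :=
  multiplicityReduction_of_initialFormReduction (initialFormReduction_of_purification hJ hP)

/-- **The route modulo `V`, `Purification` and one classical statement:**
`V → IsolatedForcesRank → Purification → S`. -/
theorem matrixMultiplication_of_quadratic_of_purification (hV : GraphEquationsQuadratic)
    (hJ : IsolatedForcesRank) (hP : Purification) : _root_.MatrixMultiplication :=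
  matrixMultiplication_of_quadratic_of_initialFormReduction hV
    (initialFormReduction_of_purification hJ hP)

end Summit.MatrixMultiplication.MatrixMultiplication.Theorems.GraphEquations

end
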